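import Literature.MathematicalPhysics.QuantumFieldTheory.ConformalBootstrap3D.CasimirPairStencil
import Literature.MathematicalPhysics.QuantumFieldTheory.ConformalBootstrap3D.MeanFieldCoefficients
import Mathlib.Tactic
import HarnessLib

/-!
# Formal block expansions in the Hogervorst–Rychkov frame and the Casimir-pair uniqueness engine

Setting (Hogervorst–Rychkov 2013 §3; Dolan–Osborn 2011 §4.2; `CasimirPairStencil`): arrays `X : ℤ → ℤ → ℝ`,
`X M j` = coefficient of `𝒫_{2p+M, j}`, for a fixed external dimension `p`. The double-twist block of the
mean-field spectrum, `(Δ, ℓ) = (2p+2n+ℓ, ℓ)`, has the array `blockArr p n ℓ` = `A(2p+2n+ℓ, ℓ)` placed at level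
`2n+ℓ`; a coefficient family `a : ℕ → ℕ → ℝ` (`a n ℓ`) defines the FORMAL BLOCK SUM
`blockSum p a = Σ_{n,ℓ} a n ℓ · blockArr p n ℓ` — at each entry a finite sum (only blocks with `2n+ℓ ≤ M` reach
level `M`), so no convergence is involved. This file proves:

* `opD2_blockSum`, `opL_blockSum` — the quadratic Casimir stencil and the closure stencil `𝕃_q` act on a formal
  block sum through the eigenvalues `C_{Δ,ℓ}` and `ℓ_q(Δ,ℓ)` of the individual blocks (`opD2_hrCoeffZ`,
  `opL_hrCoeffZ`; every mean-field block lies strictly above the unitarity bound when `p > 1/2`);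
* `ClosureRel p X Y :⟺ 𝕃_p X = μ(p) · S² Y` (`μ(p) = -p²(2p-1)²`, `S²` the shift by two levels) — the closure
  relation linking the expansion problem at `p` to the one at `p + 1`;
* `closureRel_blockSum` — a pair of coefficient families related by the twist recursion
  `a (n+1) ℓ · ℓ_p(2p+2n+2+ℓ, ℓ) = μ(p) · b n ℓ` gives block sums in the closure relation (the leading twist drops
  out because `ℓ_p` vanishes there, `clDiag_leading`); in particular the mean-field families
  `mftCoeff p n ℓ / λ_ℓ` (`closureRel_blockSum_mft`, from `mftCoeff_succ`);
* `closureRel_delta` — the source array of `u^p` (the single monomial `𝒫_{2p,0}`) is in the closure relation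
  with itself;
* `eq_of_closureRel` — **the uniqueness engine**: two families of arrays `X_i`, `Y_i` (frames `p + i`, `i ∈ ℕ`)
  that are supported on `0 ≤ j ≤ M`, `M - j` even, satisfy the closure relations `𝕃_{p+i} X_i = μ S² X_{i+1}`
  (same for `Y`) and agree on the EDGE `j = M` (the leading-twist entries) are equal — induction on the level,
  the pivot being `ℓ_{p+i}(2(p+i)+M, j) ≠ 0` for `j ≤ M - 2` (`clDiag_ne_zero`).

These are the formal (coefficient-level) steps of the mean-field decomposition; the edge identities and the
source array of `(u/v)^p` are in `MeanFieldEdge`/`GegenbauerArray`, the analytic assembly in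
`MeanFieldDecomposition`. Everything here is finite algebra. [cite: HogervorstRychkov2013, §3 eqs. (3.6)–(3.9)]
[cite: DolanOsborn2011, §4.2]
-/

namespace Literature.MathematicalPhysics.QuantumFieldTheory.ConformalBootstrap3D

open Finset

/-! ### Mean-field blocks are strictly above the unitarity bound -/

/-- For `p > 1/2` the double-twist point `(2p+2n+ℓ, ℓ)` lies strictly above the 3D unitarity bound. [folklore] -/
theorem unitarityBound3D_lt_twist {p : ℝ} (hp : 1 / 2 < p) (n ℓ : ℕ) :
    unitarityBound3D ℓ < 2 * p + 2 * n + ℓ := by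
  unfold unitarityBound3D
  have hn : (0 : ℝ) ≤ n := Nat.cast_nonneg n
  have hℓ : (0 : ℝ) ≤ ℓ := Nat.cast_nonneg ℓ
  split_ifs with h
  · linarith
  · linarith

/-! ### Block arrays and formal block sums in the frame of external dimension `p` -/

/-- The array of the double-twist block `(Δ,ℓ) = (2p+2n+ℓ, ℓ)` in the frame with base `2p`: the
Hogervorst–Rychkov array `A(Δ,ℓ)` placed at level `2n + ℓ`. [cite: HogervorstRychkov2013, §3 eq. (3.9)] -/
noncomputable def blockArr (p : ℝ) (n ℓ : ℕ) : ℤ → ℤ → ℝ := fun M j =>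
  hrCoeffZ (2 * p + 2 * n + ℓ) ℓ (M - (2 * n + ℓ : ℕ)) j

/-- A block array vanishes below its apex level `2n + ℓ`. [folklore] -/
theorem blockArr_eq_zero_of_lt (p : ℝ) {n ℓ : ℕ} {M : ℤ} (h : M < (2 * n + ℓ : ℕ)) (j : ℤ) :
    blockArr p n ℓ M j = 0 :=
  hrCoeffZ_of_neg_left _ _ (by omega) j

/-- A block array vanishes at negative spin. [folklore] -/
theorem blockArr_of_neg_right (p : ℝ) (n ℓ : ℕ) (M : ℤ) {j : ℤ} (hj : j < 0) : blockArr p n ℓ M j = 0 :=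
  hrCoeffZ_of_neg_right _ _ _ hj

/-- Support of a block array: `0 ≤ j ≤ M` and `M - j` even (from the descendant range of `A(Δ,ℓ)`). [folklore] -/
theorem blockArr_eq_zero_of_not_supp (p : ℝ) (n ℓ : ℕ) {M j : ℤ} (h : ¬ (0 ≤ j ∧ j ≤ M ∧ Even (M - j))) :
    blockArr p n ℓ M j = 0 := by
  unfold blockArr
  apply hrCoeffZ_eq_zero_of_not_inRangeZ
  rintro ⟨hj, h1, h2, h3⟩
  apply h
  obtain ⟨k, hk⟩ := h3
  push_cast at hk h1 h2
  exact ⟨hj, by omega, ⟨k + n - j, by omega⟩⟩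

/-- The block `(p, n+1, ℓ)` is the block `(p+1, n, ℓ)` shifted up by two levels. [folklore] -/
theorem blockArr_succ (p : ℝ) (n ℓ : ℕ) (M j : ℤ) :
    blockArr p (n + 1) ℓ M j = blockArr (p + 1) n ℓ (M - 2) j := by
  unfold blockArr
  have e1 : (2 * p + 2 * ((n + 1 : ℕ) : ℝ) + ℓ) = 2 * (p + 1) + 2 * (n : ℝ) + ℓ := by push_cast; ring
  have e2 : M - ((2 * (n + 1) + ℓ : ℕ) : ℤ) = M - 2 - ((2 * n + ℓ : ℕ) : ℤ) := by push_cast; ring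
  rw [e1, e2]

/-- **The formal block sum** of a coefficient family `a n ℓ` in the frame of external dimension `p`:
`(Σ_{n,ℓ} a n ℓ · blockArr p n ℓ)_{M,j}`, a finite sum at each entry. [cite: HogervorstRychkov2013, §3] -/
noncomputable def blockSum (p : ℝ) (a : ℕ → ℕ → ℝ) : ℤ → ℤ → ℝ := fun M j =>
  ∑ n ∈ range (M.toNat + 1), ∑ ℓ ∈ range (M.toNat + 1), a n ℓ * blockArr p n ℓ M j

/-- Enlarging the (finite) index range does not change a formal block sum. [folklore] -/
theorem blockSum_eq_sum_of_le (p : ℝ) (a : ℕ → ℕ → ℝ) {M : ℤ} {K : ℕ} (hK : M.toNat + 1 ≤ K) (j : ℤ) :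
    blockSum p a M j = ∑ n ∈ range K, ∑ ℓ ∈ range K, a n ℓ * blockArr p n ℓ M j := by
  unfold blockSum
  have hrow : ∀ n, ∑ ℓ ∈ range K, a n ℓ * blockArr p n ℓ M j =
      ∑ ℓ ∈ range (M.toNat + 1), a n ℓ * blockArr p n ℓ M j := by
    intro n
    apply eventually_constant_sum _ hK
    intro ℓ hℓ
    rw [blockArr_eq_zero_of_lt p (by omega) j, mul_zero]
  rw [eq_comm]
  calc ∑ n ∈ range K, ∑ ℓ ∈ range K, a n ℓ * blockArr p n ℓ M j
      = ∑ n ∈ range K, ∑ ℓ ∈ range (M.toNat + 1), a n ℓ * blockArr p n ℓ M j := sum_congr rfl fun n _ => hrow n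
    _ = ∑ n ∈ range (M.toNat + 1), ∑ ℓ ∈ range (M.toNat + 1), a n ℓ * blockArr p n ℓ M j := by
        apply eventually_constant_sum _ hK
        intro n hn
        apply sum_eq_zero
        intro ℓ _
        rw [blockArr_eq_zero_of_lt p (by omega) j, mul_zero]

/-- Support of a formal block sum: `0 ≤ j ≤ M`, `M - j` even. [folklore] -/
theorem blockSum_eq_zero_of_not_supp (p : ℝ) (a : ℕ → ℕ → ℝ) {M j : ℤ}
    (h : ¬ (0 ≤ j ∧ j ≤ M ∧ Even (M - j))) : blockSum p a M j = 0 := by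
  unfold blockSum
  apply sum_eq_zero; intro n _; apply sum_eq_zero; intro ℓ _
  rw [blockArr_eq_zero_of_not_supp p n ℓ h, mul_zero]

/-- The edge of a formal block sum: only the leading-twist blocks `n = 0`, `ℓ ≤ M` reach the entry `(M, M)`,
`blockSum p a M M = Σ_{ℓ ≤ M} a 0 ℓ · A_{M-ℓ, M}(2p+ℓ, ℓ)`. [cite: HogervorstRychkov2013, §3 eq. (3.5)] -/
theorem blockSum_edge (p : ℝ) (a : ℕ → ℕ → ℝ) (M : ℕ) :
    blockSum p a M M = ∑ ℓ ∈ range (M + 1), a 0 ℓ * hrCoeff (2 * p + ℓ) ℓ (M - ℓ) M := by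
  unfold blockSum
  rw [Int.toNat_natCast, sum_range_succ' (fun n => ∑ ℓ ∈ range (M + 1), a n ℓ * blockArr p n ℓ M M)]
  have hzero : ∑ n ∈ range M, ∑ ℓ ∈ range (M + 1), a (n + 1) ℓ * blockArr p (n + 1) ℓ M M = 0 := by
    apply sum_eq_zero; intro n _; apply sum_eq_zero; intro ℓ _
    -- the entry `(M, M)` is beyond the spin range `j ≤ ℓ + level` of a block of twist index `n + 1`
    unfold blockArr
    by_cases hlt : (M : ℤ) < ((2 * (n + 1) + ℓ : ℕ) : ℤ)
    · rw [hrCoeffZ_of_neg_left _ _ (by omega), mul_zero]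
    · obtain ⟨N, hN⟩ : ∃ N : ℕ, (M : ℤ) - ((2 * (n + 1) + ℓ : ℕ) : ℤ) = N := ⟨M - (2 * (n + 1) + ℓ), by omega⟩
      rw [hN, hrCoeffZ_natCast, hrCoeff_eq_zero_of_lt _ (by omega), mul_zero]
  rw [hzero, zero_add]
  refine sum_congr rfl fun ℓ hℓ => ?_
  rw [mem_range] at hℓ
  unfold blockArr
  have e : (M : ℤ) - ((2 * 0 + ℓ : ℕ) : ℤ) = ((M - ℓ : ℕ) : ℤ) := by push_cast; omega
  rw [e, hrCoeffZ_natCast]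
  congr 1
  push_cast; ring

/-! ### The two stencils act on formal block sums through the eigenvalues -/

/-- `opD2 (2p)` on a block array `(p,n,ℓ)` multiplies it by `C_{2p+2n+ℓ, ℓ}` (`p > 1/2`). [cite: HogervorstRychkov2013, §3 eq. (3.9)] -/
theorem opD2_blockArr {p : ℝ} (hp : 1 / 2 < p) (n ℓ : ℕ) :
    opD2 (2 * p) (blockArr p n ℓ) =
      fun M j => casimirEigenvalue3D (2 * p + 2 * n + ℓ) ℓ * blockArr p n ℓ M j := by
  unfold blockArr
  rw [opD2_shift, show (2 * p + (((2 * n + ℓ : ℕ) : ℤ) : ℝ)) = 2 * p + 2 * (n : ℝ) + ℓ by push_cast; ring,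
    opD2_hrCoeffZ (unitarityBound3D_lt_twist hp n ℓ)]

/-- `opL q (2p)` on a block array `(p,n,ℓ)` multiplies it by `ℓ_q(2p+2n+ℓ, ℓ)` (`p > 1/2`, any `q`). [cite: DolanOsborn2011, §4.2] -/
theorem opL_blockArr {p : ℝ} (hp : 1 / 2 < p) (q : ℝ) (n ℓ : ℕ) :
    opL q (2 * p) (blockArr p n ℓ) =
      fun M j => clDiag q (2 * p + 2 * n + ℓ) ℓ * blockArr p n ℓ M j := by
  unfold blockArr
  rw [opL_shift, show (2 * p + (((2 * n + ℓ : ℕ) : ℤ) : ℝ)) = 2 * p + 2 * (n : ℝ) + ℓ by push_cast; ring,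
    opL_hrCoeffZ (unitarityBound3D_lt_twist hp n ℓ)]

/-- **The quadratic stencil on a formal block sum**: `𝒟₂ (Σ a_{n,ℓ} g_{n,ℓ}) = Σ C_{n,ℓ} a_{n,ℓ} g_{n,ℓ}` at the
level of coefficient arrays. [cite: HogervorstRychkov2013, §3 eq. (3.9)] -/
theorem opD2_blockSum {p : ℝ} (hp : 1 / 2 < p) (a : ℕ → ℕ → ℝ) :
    opD2 (2 * p) (blockSum p a) =
      blockSum p (fun n ℓ => casimirEigenvalue3D (2 * p + 2 * n + ℓ) ℓ * a n ℓ) := by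
  funext M j
  set K := M.toNat + 1 with hK
  have h0 : blockSum p a M j = ∑ n ∈ range K, ∑ ℓ ∈ range K, a n ℓ * blockArr p n ℓ M j :=
    blockSum_eq_sum_of_le p a le_rfl j
  have h1 : blockSum p a (M - 1) (j - 1) = ∑ n ∈ range K, ∑ ℓ ∈ range K, a n ℓ * blockArr p n ℓ (M - 1) (j - 1) :=
    blockSum_eq_sum_of_le p a (by omega) _
  have h2 : blockSum p a (M - 1) (j + 1) = ∑ n ∈ range K, ∑ ℓ ∈ range K, a n ℓ * blockArr p n ℓ (M - 1) (j + 1) :=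
    blockSum_eq_sum_of_le p a (by omega) _
  have hR : blockSum p (fun n ℓ => casimirEigenvalue3D (2 * p + 2 * n + ℓ) ℓ * a n ℓ) M j =
      ∑ n ∈ range K, ∑ ℓ ∈ range K,
        casimirEigenvalue3D (2 * p + 2 * n + ℓ) ℓ * a n ℓ * blockArr p n ℓ M j :=
    blockSum_eq_sum_of_le p _ le_rfl j
  have hterm : ∀ n ℓ : ℕ, casimirEigenvalue3D (2 * p + 2 * n + ℓ) ℓ * a n ℓ * blockArr p n ℓ M j =
      a n ℓ * opD2 (2 * p) (blockArr p n ℓ) M j := by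
    intro n ℓ; rw [opD2_blockArr hp]; ring
  simp only [opD2] at hterm ⊢
  rw [h0, h1, h2, hR, mul_sum, mul_sum, mul_sum, ← sum_add_distrib, ← sum_add_distrib]
  refine sum_congr rfl fun n _ => ?_
  rw [mul_sum, mul_sum, mul_sum, ← sum_add_distrib, ← sum_add_distrib]
  refine sum_congr rfl fun ℓ _ => ?_
  rw [hterm]; ring

/-- **The closure stencil on a formal block sum**: `𝕃_q (Σ a_{n,ℓ} g_{n,ℓ}) = Σ ℓ_q(Δ_{n,ℓ},ℓ) a_{n,ℓ} g_{n,ℓ}`.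
[cite: DolanOsborn2011, §4.2] -/
theorem opL_blockSum {p : ℝ} (hp : 1 / 2 < p) (q : ℝ) (a : ℕ → ℕ → ℝ) :
    opL q (2 * p) (blockSum p a) =
      blockSum p (fun n ℓ => clDiag q (2 * p + 2 * n + ℓ) ℓ * a n ℓ) := by
  funext M j
  set K := M.toNat + 1 with hK
  have h0 : blockSum p a M j = ∑ n ∈ range K, ∑ ℓ ∈ range K, a n ℓ * blockArr p n ℓ M j :=
    blockSum_eq_sum_of_le p a le_rfl j
  have h1 : blockSum p a (M - 1) (j - 1) = ∑ n ∈ range K, ∑ ℓ ∈ range K, a n ℓ * blockArr p n ℓ (M - 1) (j - 1) :=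
    blockSum_eq_sum_of_le p a (by omega) _
  have h2 : blockSum p a (M - 1) (j + 1) = ∑ n ∈ range K, ∑ ℓ ∈ range K, a n ℓ * blockArr p n ℓ (M - 1) (j + 1) :=
    blockSum_eq_sum_of_le p a (by omega) _
  have h3 : blockSum p a (M - 2) j = ∑ n ∈ range K, ∑ ℓ ∈ range K, a n ℓ * blockArr p n ℓ (M - 2) j :=
    blockSum_eq_sum_of_le p a (by omega) _
  have hR : blockSum p (fun n ℓ => clDiag q (2 * p + 2 * n + ℓ) ℓ * a n ℓ) M j =
      ∑ n ∈ range K, ∑ ℓ ∈ range K, clDiag q (2 * p + 2 * n + ℓ) ℓ * a n ℓ * blockArr p n ℓ M j :=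
    blockSum_eq_sum_of_le p _ le_rfl j
  have hterm : ∀ n ℓ : ℕ, clDiag q (2 * p + 2 * n + ℓ) ℓ * a n ℓ * blockArr p n ℓ M j =
      a n ℓ * opL q (2 * p) (blockArr p n ℓ) M j := by
    intro n ℓ; rw [opL_blockArr hp]; ring
  simp only [opL] at hterm ⊢
  rw [h0, h1, h2, h3, hR, mul_sum, mul_sum, mul_sum, mul_sum, ← sum_add_distrib, ← sum_add_distrib,
    ← sum_add_distrib]
  refine sum_congr rfl fun n _ => ?_
  rw [mul_sum, mul_sum, mul_sum, mul_sum, ← sum_add_distrib, ← sum_add_distrib, ← sum_add_distrib]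
  refine sum_congr rfl fun ℓ _ => ?_
  rw [hterm]; ring

/-! ### The closure relation -/

/-- The constant `μ(p) = -p²(2p-1)²` of the closure relation (the coefficient of `u^{p+1}` in
`𝕃_p u^p = μ(p) u^{p+1}`). [folklore] -/
noncomputable def mftMu (p : ℝ) : ℝ := -(p ^ 2 * (2 * p - 1) ^ 2)

/-- **The closure relation** between an array `X` in the frame `p` and an array `Y` in the frame `p + 1`:
`𝕃_p X = μ(p) · S² Y` (`S²` = shift by two levels, i.e. multiplication by `u = z z̄`). [cite: DolanOsborn2011, §4.2] -/
def ClosureRel (p : ℝ) (X Y : ℤ → ℤ → ℝ) : Prop :=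
  ∀ M j : ℤ, opL p (2 * p) X M j = mftMu p * Y (M - 2) j

/-- The closure relation is linear (differences). [folklore] -/
theorem ClosureRel.sub {p : ℝ} {X Y X' Y' : ℤ → ℤ → ℝ} (h : ClosureRel p X Y) (h' : ClosureRel p X' Y') :
    ClosureRel p (fun M j => X M j - X' M j) (fun M j => Y M j - Y' M j) := by
  intro M j
  rw [opL_sub]
  simp only [h M j, h' M j]
  ring

/-- **Block sums in the closure relation.** If the coefficient families `a` (frame `p`) and `b` (frame `p+1`)
satisfy the twist recursion `a (n+1) ℓ · ℓ_p(2p+2n+2+ℓ, ℓ) = μ(p) · b n ℓ`, then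
`𝕃_p (blockSum p a) = μ(p) S² (blockSum (p+1) b)`: the leading twist `n = 0` drops out (`ℓ_p` vanishes there) and
the block `(p, n+1, ℓ)` is the block `(p+1, n, ℓ)` shifted by two levels. [cite: DolanOsborn2011, §4.2] -/
theorem closureRel_blockSum {p : ℝ} (hp : 1 / 2 < p) {a b : ℕ → ℕ → ℝ}
    (hrec : ∀ n ℓ, a (n + 1) ℓ * clDiag p (2 * p + 2 * ((n : ℝ) + 1) + ℓ) ℓ = mftMu p * b n ℓ) :
    ClosureRel p (blockSum p a) (blockSum (p + 1) b) := by
  intro M j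
  rw [opL_blockSum hp]
  set K := M.toNat + 3 with hK
  rw [blockSum_eq_sum_of_le p _ (show M.toNat + 1 ≤ K by omega),
    blockSum_eq_sum_of_le (p + 1) b (show (M - 2).toNat + 1 ≤ M.toNat + 2 by omega),
    show K = (M.toNat + 2) + 1 by omega, sum_range_succ']
  -- leading twist: `clDiag p (2p + 0 + ℓ) ℓ = 0`
  have hlead : ∑ ℓ ∈ range (M.toNat + 2 + 1),
      clDiag p (2 * p + 2 * ((0 : ℕ) : ℝ) + ℓ) ℓ * a 0 ℓ * blockArr p 0 ℓ M j = 0 := by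
    apply sum_eq_zero; intro ℓ _
    rw [show 2 * p + 2 * ((0 : ℕ) : ℝ) + ℓ = 2 * p + ℓ by push_cast; ring, clDiag_leading]; ring
  rw [hlead, add_zero, mul_sum]
  refine sum_congr rfl fun n _ => ?_
  -- inner sum over `ℓ`: the extra index `ℓ = M.toNat + 2` on the left contributes zero
  rw [sum_range_succ _ (M.toNat + 2),
    blockArr_eq_zero_of_lt p (show M < ((2 * (n + 1) + (M.toNat + 2) : ℕ) : ℤ) by omega), mul_zero,
    add_zero, mul_sum]
  refine sum_congr rfl fun ℓ _ => ?_
  rw [show (2 * p + 2 * ((n + 1 : ℕ) : ℝ) + ℓ) = 2 * p + 2 * ((n : ℝ) + 1) + ℓ by push_cast; ring,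
    show clDiag p (2 * p + 2 * ((n : ℝ) + 1) + ℓ) ℓ * a (n + 1) ℓ * blockArr p (n + 1) ℓ M j =
      (a (n + 1) ℓ * clDiag p (2 * p + 2 * ((n : ℝ) + 1) + ℓ) ℓ) * blockArr p (n + 1) ℓ M j by ring,
    hrec, blockArr_succ]
  ring

/-- **The mean-field coefficient families are in the twist recursion**: with `a_q n ℓ = mftCoeff q n ℓ / λ_ℓ`
(any fixed sign pattern `ε ℓ` in `ℓ` allowed), `a_p (n+1) ℓ · ℓ_p(…) = μ(p) · a_{p+1} n ℓ` (`mftCoeff_succ`).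
[cite: FitzpatrickKaplan2012, §2.2] -/
theorem mft_twist_rec {p : ℝ} (hp : 1 / 2 < p) (ε : ℕ → ℝ) (n ℓ : ℕ) :
    ε ℓ * mftCoeff p (n + 1) ℓ / legendreLam ℓ * clDiag p (2 * p + 2 * ((n : ℝ) + 1) + ℓ) ℓ =
      mftMu p * (ε ℓ * mftCoeff (p + 1) n ℓ / legendreLam ℓ) := by
  rw [mftCoeff_succ hp, mftMu]
  have hn : (0 : ℝ) ≤ n := Nat.cast_nonneg n
  have hℓ : (0 : ℝ) ≤ ℓ := Nat.cast_nonneg ℓ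
  have h3 : (0 : ℝ) < (n : ℝ) + 2 * p - 1 := by linarith
  have h4 : (0 : ℝ) < 2 * (ℓ : ℝ) + 2 * n + 4 * p - 1 := by linarith
  set D : ℝ := ((n : ℝ) + 1) * (2 * ℓ + 2 * n + 3) * (n + 2 * p - 1) * (2 * ℓ + 2 * n + 4 * p - 1) with hDdef
  have hD : D ≠ 0 := by rw [hDdef]; positivity
  have key : clDiag p (2 * p + 2 * ((n : ℝ) + 1) + ℓ) ℓ = -D := by
    rw [hDdef]; unfold clDiag; ring
  rw [key]
  calc ε ℓ * (p ^ 2 * (2 * p - 1) ^ 2 / D * mftCoeff (p + 1) n ℓ) / legendreLam ℓ * -D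
      = -(p ^ 2 * (2 * p - 1) ^ 2 * (D / D)) * (ε ℓ * mftCoeff (p + 1) n ℓ / legendreLam ℓ) := by ring
    _ = -(p ^ 2 * (2 * p - 1) ^ 2) * (ε ℓ * mftCoeff (p + 1) n ℓ / legendreLam ℓ) := by
        rw [div_self hD, mul_one]

/-- **The mean-field block sums are in the closure relation** (frame `p` to frame `p+1`), for any fixed sign
pattern `ε ℓ` (`ε = 1`: the `(u/v)^p` family; `ε ℓ = (-1)^ℓ`: the `u^p` family). [cite: FitzpatrickKaplan2012, §2.2] -/
theorem closureRel_blockSum_mft {p : ℝ} (hp : 1 / 2 < p) (ε : ℕ → ℝ) :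
    ClosureRel p (blockSum p (fun n ℓ => ε ℓ * mftCoeff p n ℓ / legendreLam ℓ))
      (blockSum (p + 1) (fun n ℓ => ε ℓ * mftCoeff (p + 1) n ℓ / legendreLam ℓ)) :=
  closureRel_blockSum hp fun n ℓ => mft_twist_rec hp ε n ℓ

/-! ### The source array of `u^p` -/

/-- The array of `u^p = 𝒫_{2p,0}` in its own frame: `δ_{(M,j),(0,0)}`. [folklore] -/
noncomputable def deltaArr : ℤ → ℤ → ℝ := fun M j => if M = 0 ∧ j = 0 then 1 else 0

/-- `deltaArr` is supported on `0 ≤ j ≤ M`, `M - j` even. [folklore] -/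
theorem deltaArr_eq_zero_of_not_supp {M j : ℤ} (h : ¬ (0 ≤ j ∧ j ≤ M ∧ Even (M - j))) : deltaArr M j = 0 := by
  unfold deltaArr
  rw [if_neg]
  rintro ⟨rfl, rfl⟩
  exact h ⟨le_rfl, le_rfl, ⟨0, by norm_num⟩⟩

/-- **`u^p` is in the closure relation with `u^{p+1}`**: `𝕃_p 𝒫_{2p,0} = μ(p) 𝒫_{2p+2,0}` (the coefficients of
`𝒫_{2p,0}`, `𝒫_{2p+1,1}` in `𝕃_p 𝒫_{2p,0}` vanish: `clDiag p (2p) 0 = clUp p (2p) 0 = 0`, and `clTwo (2p) 0 = μ(p)`).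
[cite: DolanOsborn2011, §4.2] -/
theorem closureRel_delta (p : ℝ) : ClosureRel p deltaArr deltaArr := by
  intro M j
  have hdiag : clDiag p (2 * p) 0 = 0 := by unfold clDiag; ring
  have hup : clUp p (2 * p) 0 = 0 := by unfold clUp; ring
  have htwo : clTwo (2 * p) 0 = mftMu p := by unfold clTwo mftMu; ring
  simp only [opL, deltaArr]
  rcases (by omega : M = 0 ∨ M = 1 ∨ M = 2 ∨ (M ≠ 0 ∧ M ≠ 1 ∧ M ≠ 2)) with h0 | h1 | h2 | hne
  · subst h0
    by_cases hj : j = 0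
    · subst hj; simp [hdiag]
    · simp [hj]
  · subst h1
    by_cases hj : j = 1
    · subst hj; norm_num [hup]
    · by_cases hj' : j = -1
      · subst hj'; norm_num
      · have e1 : ¬ (j - 1 = 0) := by omega
        have e2 : ¬ (j + 1 = 0) := by omega
        simp [e1, e2]
  · subst h2
    by_cases hj : j = 0
    · subst hj; norm_num [htwo]
    · simp [hj]
  · obtain ⟨h0, h1, h2⟩ := hne
    have e1 : ¬ (M - 1 = 0) := by omega
    have e2 : ¬ (M - 2 = 0) := by omega
    simp [h0, e1, e2]

/-! ### The uniqueness engine -/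

/-- **Uniqueness from the closure relations, the support and the edge.** Let `X i`, `Y i` (`i ∈ ℕ`) be arrays in
the frames `p + i` (`p > 1/2`), supported on `0 ≤ j ≤ M`, `M - j` even, each family satisfying the closure
relations `𝕃_{p+i} X_i = μ(p+i) S² X_{i+1}`, and agreeing on the edge `j = M`. Then `X i = Y i` for all `i`.
Proof: the differences `E_i` satisfy the same relations with zero edge; by induction on the level `M`, at an
entry `(M, j)` with `j ≤ M - 2` the relation reads `ℓ_{p+i}(2(p+i)+M, j) E_i(M,j) + (lower levels) = μ E_{i+1}(M-2, j)`,
and `ℓ_{p+i} ≠ 0` there (`clDiag_ne_zero`). [cite: DolanOsborn2011, §4.2] -/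
theorem eq_of_closureRel {p : ℝ} (hp : 1 / 2 < p) (X Y : ℕ → ℤ → ℤ → ℝ)
    (hX : ∀ i : ℕ, ClosureRel (p + i) (X i) (X (i + 1)))
    (hY : ∀ i : ℕ, ClosureRel (p + i) (Y i) (Y (i + 1)))
    (hXs : ∀ i M j, ¬ (0 ≤ j ∧ j ≤ M ∧ Even (M - j)) → X i M j = 0)
    (hYs : ∀ i M j, ¬ (0 ≤ j ∧ j ≤ M ∧ Even (M - j)) → Y i M j = 0)
    (hedge : ∀ i (M : ℤ), X i M M = Y i M M) :
    ∀ i, X i = Y i := by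
  -- differences
  set E : ℕ → ℤ → ℤ → ℝ := fun i M j => X i M j - Y i M j with hE
  have hEc : ∀ i : ℕ, ClosureRel (p + i) (E i) (E (i + 1)) := fun i => (hX i).sub (hY i)
  have hEs : ∀ (i : ℕ) (M j : ℤ), ¬ (0 ≤ j ∧ j ≤ M ∧ Even (M - j)) → E i M j = 0 := by
    intro i M j h; simp only [hE, hXs i M j h, hYs i M j h, sub_zero]
  have hEe : ∀ (i : ℕ) (M : ℤ), E i M M = 0 := by
    intro i M; simp only [hE, hedge i M, sub_self]
  -- induction on the level
  have main : ∀ N : ℕ, ∀ (i : ℕ) (M j : ℤ), M ≤ N → E i M j = 0 := by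
    intro N
    induction N with
    | zero =>
      intro i M j hM
      by_cases h : 0 ≤ j ∧ j ≤ M ∧ Even (M - j)
      · have hM0 : M = 0 := by push_cast at hM; omega
        have hj0 : j = 0 := by omega
        subst hM0; subst hj0
        exact hEe i 0
      · exact hEs i M j h
    | succ N ih =>
      intro i M j hM
      by_cases hle : M ≤ N
      · exact ih i M j hle
      have hMN : M = N + 1 := by push_cast at hM; omega
      by_cases h : 0 ≤ j ∧ j ≤ M ∧ Even (M - j)
      swap
      · exact hEs i M j h
      obtain ⟨hj, hjM, hpar⟩ := h
      by_cases hjM' : j = M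
      · subst hjM'; exact hEe i j
      have hj2 : j + 2 ≤ M := by
        obtain ⟨k, hk⟩ := hpar; omega
      -- the closure relation at `(M, j)`
      have hc := hEc i M j
      simp only [opL] at hc
      rw [ih i (M - 1) (j - 1) (by omega), ih i (M - 1) (j + 1) (by omega), ih i (M - 2) j (by omega),
        ih (i + 1) (M - 2) j (by omega)] at hc
      have hc' : clDiag (p + i) (2 * (p + i) + (M : ℝ)) j * E i M j = 0 := by
        have := hc; push_cast at this ⊢; linarith
      have hpi : 1 / 2 < p + i := by have : (0 : ℝ) ≤ i := Nat.cast_nonneg i; linarith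
      rcases mul_eq_zero.mp hc' with h0 | h0
      · exact absurd h0 (clDiag_ne_zero hpi hj hj2 hpar)
      · exact h0
  intro i
  funext M j
  have := main (M.toNat) i M j (by omega)
  simp only [hE] at this
  linarith

end Literature.MathematicalPhysics.QuantumFieldTheory.ConformalBootstrap3D
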